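import Literature.MathematicalPhysics.QuantumFieldTheory.Balaban1983to89.B9Eq3120DeltaPiPrimeFormTwoBackgrounds
import Literature.MathematicalPhysics.QuantumFieldTheory.Balaban1983to89.B9Eq325GaugeModeLetterTwoBackgrounds
import Literature.MathematicalPhysics.QuantumFieldTheory.Balaban1983to89.B9Eq3119DeltaPiTower

/-!
# `Balaban1983to89.B9Eq3120DeltaPiPrimeFormTwoBackgroundsClosed` — T. Bałaban, *Propagators for lattice gauge theories in a background field*, Commun. Math.
# Phys. **99** (1985) 389–434 [Balaban1985BackgroundPropagators] (3.119)–(3.120) p. 419, (3.122) p. 420, (3.36) p. 396, Thm 3.4 p. 400, Thm 3.11 p. 416: **THE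
# θ-DEFECT OF THE `Δ_π` SLOT IS LIPSCHITZ IN THE BACKGROUND ON PRINT's DIAGONAL, WITH THE `λ`-LETTERS INHABITED — `‖(⟨u, (π_k(U)†Δ^η(U)π_k(U))v⟩ − ⟨u, Δ^η(U)v⟩)
# − (⟨u, (π_k(V)†Δ^η(V)π_k(V))v⟩ − ⟨u, Δ^η(V)v⟩)‖ ≤ Θ·δ·N₁(u)N₁(v)` WITH ONE `∃ α₀ δ₀ Θ` BEFORE EVERY BINDER, AT `π_k(X) = 1 − D_XG′_k(X)R_k(X)D*_X`** — the
# closing corollary of this lineage's `B9Eq3120DeltaPiPrimeFormTwoBackgrounds` on NE9 leaf-02's `B9Eq325GaugeModeLetterDiagonal` (at `U` and at `V`) and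
# this lineage's (T2) `B9Eq325GaugeModeLetterTwoBackgrounds`; the two-background («(b3)») twin of leaf-02's `B9Eq3120DeltaPiPrimeFormDiagonalClosed`

statement-level skeleton of published theorems with citation tags; proofs where landed; nothing here is a claim about the Yang–Mills mass gap

PDF held: `paper:balaban1985-cmp99-background-propagators` (journal page = PDF page + 388), pp. 394, 396, 400, 416, 419–420 — read by this lineage first-hand (gens
73–78) and through the suppliers' verbatim quotations.

CITATION HEADER (lean-in-tree rule 2026-08-18).  Audit cell `pub-balaban`, sub-cell `t4`, NE9 crux team (2): LEAF PROVER 04 (`b2b-balaban-t4-ne9-formalise-leaf-04`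
gen 79), INTENT-2 (storey (T3) of the two-background θ-letter of the row OWNER t4-ne9-p1's `Δ_π` port, CLOSED; his GO `CLAIMS.log` l.53352 W-9 (α)).  WHY (cell
context): the (T4) π twins of this lineage's two-background energy rows (`B9Eq353FormDefectTowerTwoBackgrounds` → `…GreenkLipschitzEnergyTwoBackgrounds` → …
→ `B11Eq174ChartContinuityTowerTwoBackgrounds`, all at the chain's `G₀`-slot `laplaceAk`) need, at print's slot `laplaceAkPi` ((3.122); `B9Eq3119DeltaPiTower`),
exactly one new letter: the two-background form defect of the `Δ₁`-slot `π_k(X)†Δ^η(X)π_k(X)` against `Δ^η(X)`, with `∃ α₀ δ₀ Θ` FIRST.  This file is that letter;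
the `Δ₁`-slot is spelled `LinearMap.adjoint (piOfUk …) ∘ₗ hessOp φ η X τ ∘ₗ piOfUk …`, TOKEN-IDENTICAL with `laplaceAkPi`'s (tree text of `B9Eq3119DeltaPiTower`).

THE PRINT.  p. 419 (verbatim via the OWNER's host): *«(A, Δ_πA) = ⟨A − DG′RD*A, Δ(A − DG′RD*A)⟩ (3.119) … The quadratic form Δ′_π is a small perturbation of Δ»*;
p. 400 Thm 3.4 (verbatim via (T2)): *«G(U) is an analytic function of U′ on the space of configurations U′ satisfying (3.35)»* — read in the cell as Lipschitz
continuity between two points of the small-field ball, to first order; p. 416 Thm 3.11 (the positivity behind `G′_k`, displayed as `hpos′`).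

WHAT IS PROVED (sorry-free; proof lane — no `def`, no `Prop` placeholder; [folklore] composition BY NAME + threshold arithmetic).
* **`exists_form_defect_pi_sub_diagonal_closed`** — `∃ α₀ δ₀ Θ > 0` (closed in `(d, L, M_φ, M_φ′, a′, r, C_τ, ρ_w)`) such that on the diagonal `ηL^{n+1} = 1`,
  `c₀(L^{n+1})^d = c₁`, `|η|^d∕c₀ ≤ ρ_w`, for two backgrounds `U`, `V` with mutually adjoint transporters, `U1`-valued, in the bond ∕ plaquette windows `αη` ∕ `αη²`,
  close (`‖U(b) − V(b)‖ ≤ δη`, `‖U(∂p) − V(∂p)‖ ≤ δη²`), with `U1`-valued level averages in a common profile `ε_j ≤ αr^j` and close level averages `δ_j ≤ δr^j`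
  (`j < n+1`), `0 ≤ α ≤ α₀`, `0 ≤ δ ≤ δ₀`, ANY positivity witnesses `hpos′_U`, `hpos′_V` of `Δ′_{a′,k}(U)`, `Δ′_{a′,k}(V)` and all `u, v`:
  `‖(⟨u, (π_k(U)†Δ^η(U)π_k(U))v⟩ − ⟨u, Δ^η(U)v⟩) − (⟨u, (π_k(V)†Δ^η(V)π_k(V))v⟩ − ⟨u, Δ^η(V)v⟩)‖ ≤ Θ·δ·N₁(u)N₁(v)`, `π_k(X) = piOfUk … X (GpOfUk … X a′ hpos′_X)`,
  `N₁(w) = √(‖curl₁w‖² + ‖div₁w‖² + ‖w‖²)`.  MECHANISM: `⟨u, π†Δπv⟩ = ⟨πu, Δπv⟩` (`LinearMap.adjoint_inner_right`), `π_k(X)w = w − D_Xλ_X(w)` (unfolding `piOfUk`);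
  then `B9Eq3120DeltaPiPrimeFormTwoBackgrounds.norm_form_defect_pi_sub_le` with its six `λ`-letters INHABITED: `C_λ = C_λ′ := C₁` from leaf-02's
  `exists_gaugeMode_letters_diagonal` at `U` AND at `V`, `C_δ := C₂` from (T2) `exists_gaugeMode_letters_two_backgrounds`; `0 < η ≤ 1` from the diagonal;
  `α₀ = min(α₁, α₂, 1)`, `δ₀ = δ₂`, `Θ = Θ̃(C₁, C₁, C₂) + 1`.
MODEL ∕ DECLARED READINGS.  (M1) those of (T2) (tower `towerP L m`, fibre `W` along `φ`, weights `c₀`, `c₁`, scalar `η⁻¹` on the diagonal, real `a′ > 0`, geometric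
profile ratio `r < 1`, trace `τ` with `‖τX‖ ≤ C_τ‖X‖`).  (M2) `hRS` ×2, `U1` ×2, the four windows, the two closeness windows, the averaged windows and the averaged
closeness `δ_j` (the Lipschitz continuity `U ↦ Ū` is NOT proved here), `ρ_w`, `hpos′_U`, `hpos′_V` are HYPOTHESES.
HONEST SCOPE.  [folklore] composition BY NAME; FIRST order between two small backgrounds on the diagonal ONLY; crude constants; the bare slot defect
`⟨u, (Δ^η(U) − Δ^η(V))v⟩` and the `laplaceAkPi` reading are NOT here (the former is gen-77 `B9Eq353FormDefectTowerTwoBackgrounds` at the `G₀`-slot, the latter the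
(T4) twin); no current `J`, no analyticity.  NOT summit progress (cell pub-balaban: NE9 NOT PRINTED ∕ NOT PROVED; «NE9 ⇐ the named binders»; row WALLED ON A MODEL
(O-NE9-1; NEEDS-COORDINATOR #5 UNRULED); spine PROVED 0∕9; rung (B)+1 finite T⁴ — NOT infinite volume, NOT mass gap, NOT BetaPertH, NOT Clay).  HONEST DEPENDENCY
(cell line): continuum YM on T⁴ ⇐ BetaPertH ∧ nine spine estimates (0/9 proved); BetaPertH ⇐ (D1) ∧ (D4) ∧ CAP+tail; G-an2-4 gates asym, D1 and NE2/3/4.  NEW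
file; nothing modified.  Net new unproved facts: 0.
-/

noncomputable section

open scoped BigOperators InnerProductSpace ComplexConjugate

namespace Literature.MathematicalPhysics.QuantumFieldTheory.Balaban1983to89.B9Eq3120DeltaPiPrimeFormTwoBackgroundsClosed

open B4Sect5Torus (TSite)
open B9SectCLatticeCarrier (Bond DirPair)
open B7Prop1Explicit (U1)
open B11Eq103H1Complex (SiteL2K BondL2K covDerivL2K covDivL2K)
open B9Eq310HessianOperator (adTransportW hessOp covCurlL2K)
open B9Eq310DeltaPrime (plaqHolU)
open B9Eq315QTower (towerP UlevOf)
open B9Eq326OperatorTower (RofUk)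
open B9Eq324DeltaPrimeATower (laplacePrimeAk GpOfUk)
open B9Eq3119DeltaPiTower (piOfUk)
open B9Eq325GaugeModeLetterDiagonal (exists_gaugeMode_letters_diagonal)
open B9Eq325GaugeModeLetterTwoBackgrounds (exists_gaugeMode_letters_two_backgrounds)
open B9Eq3120DeltaPiPrimeFormTwoBackgrounds (norm_form_defect_pi_sub_le)

variable {d : ℕ} (L : ℕ) [NeZero L]
  {𝔸 : Type*} [NormedRing 𝔸] [NormedAlgebra ℂ 𝔸] [CompleteSpace 𝔸] [NormOneClass 𝔸] [StarRing 𝔸] [NormedStarGroup 𝔸] [StarModule ℂ 𝔸]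
  {W : Type*} [NormedAddCommGroup W] [InnerProductSpace ℂ W] [FiniteDimensional ℂ W] (φ : W ≃ₗ[ℂ] 𝔸)
  {Mφ Mφ' : ℝ} (hMφ : 0 ≤ Mφ) (hMφ' : 0 ≤ Mφ') (hφ : ∀ w, ‖φ w‖ ≤ Mφ * ‖w‖) (hφ' : ∀ X, ‖φ.symm X‖ ≤ Mφ' * ‖X‖)
  {a' : ℝ} (ha' : 0 < a') {r : ℝ} (hr0 : 0 ≤ r) (hr1 : r < 1)
  (τ : 𝔸 →ₗ[ℂ] ℂ) {Cτ : ℝ} (hτ : ∀ X, ‖τ X‖ ≤ Cτ * ‖X‖) (hCτ : 0 ≤ Cτ) {ρw : ℝ} (hρw : 0 ≤ ρw)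

omit [NormOneClass 𝔸] [StarRing 𝔸] [NormedStarGroup 𝔸] [StarModule ℂ 𝔸] in
/-- unfolding `π_k(X)w = w − D_X(G′(R_k(X)(D*_Xw)))`. [cite: Balaban1985BackgroundPropagators, (3.119) p.419] -/
private theorem piOfUk_apply (m : Fin d → ℕ) [∀ i, NeZero (m i)] (n : ℕ) {c₀ : ℝ} [Fact (0 < c₀)] (η : ℝ)
    (X : Bond d (towerP L m (n + 1)) → 𝔸ˣ) (Gp : SiteL2K ℂ d (towerP L m (n + 1)) c₀ W →ₗ[ℂ] SiteL2K ℂ d (towerP L m (n + 1)) c₀ W)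
    (w : BondL2K ℂ d (towerP L m (n + 1)) c₀ W) :
    piOfUk L m n φ η X Gp w = w - covDerivL2K ℂ c₀ ((η : ℂ))⁻¹ (adTransportW φ X) (Gp (RofUk L m n φ η X
      (covDivL2K ℂ c₀ ((η : ℂ))⁻¹ (adTransportW φ fun b => (X b)⁻¹) w))) := by
  simp only [piOfUk, LinearMap.sub_apply, LinearMap.id_apply, LinearMap.comp_apply]

include hMφ hMφ' hφ hφ' ha' hr0 hr1 hτ hCτ hρw in
/-- **THE θ-DEFECT OF THE `Δ_π` SLOT IS LIPSCHITZ IN THE BACKGROUND, ON THE DIAGONAL, CLOSED** — see the module header: `∃ α₀ δ₀ Θ > 0` before every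
binder such that `‖(⟨u, (π_k(U)†Δ^η(U)π_k(U))v⟩ − ⟨u, Δ^η(U)v⟩) − (⟨u, (π_k(V)†Δ^η(V)π_k(V))v⟩ − ⟨u, Δ^η(V)v⟩)‖ ≤ Θ·δ·N₁(u)N₁(v)` for two `δ`-close small
backgrounds in the windows, modulo the averaged profiles, `ρ_w` and ANY `hpos′_U`, `hpos′_V`; the `Δ₁`-slots are those of `B9Eq3119DeltaPiTower.laplaceAkPi` at
`U` and at `V` by name. [folklore] [cite: Balaban1985BackgroundPropagators, (3.119)–(3.120) p.419, (3.122) p.420, Thm 3.4 p.400, Thm 3.11 p.416, (3.36) p.396] -/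
theorem exists_form_defect_pi_sub_diagonal_closed :
    ∃ α₀ δ₀ Θ : ℝ, 0 < α₀ ∧ 0 < δ₀ ∧ 0 < Θ ∧ ∀ (n : ℕ) (η : ℝ), η * (L : ℝ) ^ (n + 1) = 1 →
      ∀ (c₀ c₁ : ℝ) [Fact (0 < c₀)] [Fact (0 < c₁)], c₀ * ((L : ℝ) ^ (n + 1)) ^ d = c₁ → |η| ^ d / c₀ ≤ ρw →
      ∀ (m : Fin d → ℕ) [∀ i, NeZero (m i)] (U V : Bond d (towerP L m (n + 1)) → 𝔸ˣ),
        (∀ (b : Bond d (towerP L m (n + 1))) (v u : W), ⟪adTransportW φ U b v, u⟫_ℂ = ⟪v, adTransportW φ (fun b => (U b)⁻¹) b u⟫_ℂ) →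
        (∀ (b : Bond d (towerP L m (n + 1))) (v u : W), ⟪adTransportW φ V b v, u⟫_ℂ = ⟪v, adTransportW φ (fun b => (V b)⁻¹) b u⟫_ℂ) →
      ∀ (α δ : ℝ), 0 ≤ α → α ≤ α₀ → 0 ≤ δ → δ ≤ δ₀ →
        (∀ b, U b ∈ U1 𝔸) → (∀ b, V b ∈ U1 𝔸) → (∀ b, ‖(U b : 𝔸) - 1‖ ≤ α * η) → (∀ b, ‖(V b : 𝔸) - 1‖ ≤ α * η) →
        (∀ b, ‖(U b : 𝔸) - (V b : 𝔸)‖ ≤ δ * η) →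
        (∀ p : B9SectCLatticeCarrier.Plaq d (towerP L m (n + 1)), ‖(plaqHolU U p : 𝔸) - 1‖ ≤ α * η ^ 2) →
        (∀ p : B9SectCLatticeCarrier.Plaq d (towerP L m (n + 1)), ‖(plaqHolU V p : 𝔸) - 1‖ ≤ α * η ^ 2) →
        (∀ p : B9SectCLatticeCarrier.Plaq d (towerP L m (n + 1)), ‖(plaqHolU U p : 𝔸) - (plaqHolU V p : 𝔸)‖ ≤ δ * η ^ 2) →
      ∀ (εU δUV : ℕ → ℝ), (∀ j, 0 ≤ εU j) → (∀ j, 0 ≤ δUV j) → (∀ j < n + 1, εU j ≤ α * r ^ j) → (∀ j < n + 1, δUV j ≤ δ * r ^ j) →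
        (∀ (j : ℕ) (b : Bond d (towerP L m (j + 1))), ‖(UlevOf L m (n + 1) U j b : 𝔸) - 1‖ ≤ εU j) →
        (∀ (j : ℕ) (b : Bond d (towerP L m (j + 1))), ‖(UlevOf L m (n + 1) V j b : 𝔸) - 1‖ ≤ εU j) →
        (∀ (j : ℕ) (b : Bond d (towerP L m (j + 1))), UlevOf L m (n + 1) U j b ∈ U1 𝔸) →
        (∀ (j : ℕ) (b : Bond d (towerP L m (j + 1))), UlevOf L m (n + 1) V j b ∈ U1 𝔸) →
        (∀ (j : ℕ) (b : Bond d (towerP L m (j + 1))), ‖(UlevOf L m (n + 1) U j b : 𝔸) - (UlevOf L m (n + 1) V j b : 𝔸)‖ ≤ δUV j) →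
      ∀ (hposU : ∀ x : SiteL2K ℂ d (towerP L m (n + 1)) c₀ W, x ≠ 0 → 0 < RCLike.re ⟪x, laplacePrimeAk L m n φ η U a' (c₁ := c₁) x⟫_ℂ)
        (hposV : ∀ x : SiteL2K ℂ d (towerP L m (n + 1)) c₀ W, x ≠ 0 → 0 < RCLike.re ⟪x, laplacePrimeAk L m n φ η V a' (c₁ := c₁) x⟫_ℂ)
        (u v : BondL2K ℂ d (towerP L m (n + 1)) c₀ W),
    ‖(⟪u, (LinearMap.adjoint (piOfUk L m n φ η U (GpOfUk L m n φ η U a' hposU)) ∘ₗ hessOp φ η U τ ∘ₗ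
            piOfUk L m n φ η U (GpOfUk L m n φ η U a' hposU)) v⟫_ℂ - ⟪u, hessOp φ η U τ v⟫_ℂ) -
        (⟪u, (LinearMap.adjoint (piOfUk L m n φ η V (GpOfUk L m n φ η V a' hposV)) ∘ₗ hessOp φ η V τ ∘ₗ
            piOfUk L m n φ η V (GpOfUk L m n φ η V a' hposV)) v⟫_ℂ - ⟪u, hessOp φ η V τ v⟫_ℂ)‖ ≤
      Θ * δ *
        Real.sqrt (‖covCurlL2K ℂ c₀ ((η : ℂ))⁻¹ (adTransportW φ (fun _ : Bond d (towerP L m (n + 1)) => (1 : 𝔸ˣ))) u‖ ^ 2 +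
          ‖covDivL2K ℂ c₀ ((η : ℂ))⁻¹ (adTransportW φ fun _ : Bond d (towerP L m (n + 1)) => (1 : 𝔸ˣ)⁻¹) u‖ ^ 2 + ‖u‖ ^ 2) *
        Real.sqrt (‖covCurlL2K ℂ c₀ ((η : ℂ))⁻¹ (adTransportW φ (fun _ : Bond d (towerP L m (n + 1)) => (1 : 𝔸ˣ))) v‖ ^ 2 +
          ‖covDivL2K ℂ c₀ ((η : ℂ))⁻¹ (adTransportW φ fun _ : Bond d (towerP L m (n + 1)) => (1 : 𝔸ˣ)⁻¹) v‖ ^ 2 + ‖v‖ ^ 2) := by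
  obtain ⟨α₁, C₁, hα₁, hC₁, HL⟩ := exists_gaugeMode_letters_diagonal (d := d) L φ hMφ hMφ' hφ hφ' ha' hr0 hr1
  obtain ⟨α₂, δ₂, C₂, hα₂, hδ₂, hC₂, HT⟩ := exists_gaugeMode_letters_two_backgrounds (d := d) L φ hMφ hMφ' hφ hφ' ha' hr0 hr1
  -- the letters of the abstract assembly, closed in the data
  obtain ⟨a, ha⟩ : ∃ x : ℝ, x = 2 * (Mφ' * Mφ) * Real.sqrt (Fintype.card (DirPair d)) := ⟨_, rfl⟩
  obtain ⟨s, hs⟩ : ∃ x : ℝ, x = 8 * Real.sqrt d * (Mφ * Mφ') := ⟨_, rfl⟩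
  obtain ⟨b, hb⟩ : ∃ x : ℝ, x = 1 + s := ⟨_, rfl⟩
  obtain ⟨κ, hκ⟩ : ∃ x : ℝ, x = 32 * d * Cτ * Mφ ^ 2 * ρw := ⟨_, rfl⟩
  obtain ⟨κ', hκ'⟩ : ∃ x : ℝ, x = 240 * d * Cτ * Mφ ^ 2 * ρw := ⟨_, rfl⟩
  obtain ⟨P, hP⟩ : ∃ x : ℝ, x = a * (5 * C₁ + C₂) := ⟨_, rfl⟩
  obtain ⟨P', hP'⟩ : ∃ x : ℝ, x = s * a * C₁ + κ' * C₁ + κ * C₂ := ⟨_, rfl⟩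
  obtain ⟨Θ, hΘ⟩ : ∃ x : ℝ, x = (2 * (P * b + P') + (a * C₁ * P + C₁ * P') + ((s * C₁ + P) * a * C₁ + κ * C₁ * C₂)) + 1 := ⟨_, rfl⟩
  have ha0 : 0 ≤ a := by rw [ha]; positivity
  have hs0 : 0 ≤ s := by rw [hs]; positivity
  have hb0 : 0 ≤ b := by rw [hb]; exact add_nonneg zero_le_one hs0
  have hκ0 : 0 ≤ κ := by rw [hκ]; exact mul_nonneg (by positivity) hρw
  have hκ'0 : 0 ≤ κ' := by rw [hκ']; exact mul_nonneg (by positivity) hρw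
  have hP0 : 0 ≤ P := by rw [hP]; exact mul_nonneg ha0 (by positivity)
  have hP'0 : 0 ≤ P' := by rw [hP']; positivity
  have hΘ1 : (2 * (P * b + P') + (a * C₁ * P + C₁ * P') + ((s * C₁ + P) * a * C₁ + κ * C₁ * C₂)) ≤ Θ := by rw [hΘ]; linarith
  have hΘ0 : 0 < Θ := by
    have : 0 ≤ (2 * (P * b + P') + (a * C₁ * P + C₁ * P') + ((s * C₁ + P) * a * C₁ + κ * C₁ * C₂)) := by positivity
    rw [hΘ]; linarith
  refine ⟨min α₁ (min α₂ 1), δ₂, Θ, lt_min hα₁ (lt_min hα₂ one_pos), hδ₂, hΘ0, ?_⟩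
  intro n η hηL c₀ c₁ _ _ hw hρ m _ U V hRSU hRSV α δ hα0 hαle hδ0 hδle hUb hVb hUη hVη hUV hplU hplV hpp εU δUV hεU hδUV hεg hδg
    hLεU hLεV hLbU hLbV hLUV hposU hposV u v
  have hα₁' : α ≤ α₁ := hαle.trans (min_le_left _ _)
  have hα₂' : α ≤ α₂ := hαle.trans ((min_le_right _ _).trans (min_le_left _ _))
  have hα1 : α ≤ 1 := hαle.trans ((min_le_right _ _).trans (min_le_right _ _))
  have hL1 : (1 : ℝ) ≤ (L : ℝ) ^ (n + 1) := one_le_pow₀ (by exact_mod_cast Nat.one_le_iff_ne_zero.2 (NeZero.ne L))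
  have hη : 0 < η := pos_of_mul_pos_left (by rw [hηL]; exact one_pos) (zero_le_one.trans hL1)
  have hη1 : η ≤ 1 := by
    calc η = η * 1 := (mul_one η).symm
      _ ≤ η * (L : ℝ) ^ (n + 1) := mul_le_mul_of_nonneg_left hL1 hη.le
      _ = 1 := hηL
  -- the λ-letters at `U`, at `V`, and between them
  have HU := fun w => HL n η hηL c₀ c₁ hw m U hRSU α hα0 hα₁' hUb hUη εU hεU hεg hLεU hLbU hposU w
  have HV := fun w => HL n η hηL c₀ c₁ hw m V hRSV α hα0 hα₁' hVb hVη εU hεU hεg hLεV hLbV hposV w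
  have HUV := fun w => HT n η hηL c₀ c₁ hw m U V hRSU hRSV α δ hα0 hα₂' hδ0 hδle hUb hVb hUη hVη hUV εU δUV hεU hδUV hεg hδg
    hLεU hLεV hLbU hLbV hLUV hposU hposV w
  have h := norm_form_defect_pi_sub_le φ hMφ hMφ' hφ hφ' τ hτ hCτ hη hη1 hρ U V hRSU hRSV hUb hVb hα0 hα1 hδ0 hUη hUV hplU hplV hpp
    (fun z => Real.sqrt (‖covCurlL2K ℂ c₀ ((η : ℂ))⁻¹ (adTransportW φ (fun _ : Bond d (towerP L m (n + 1)) => (1 : 𝔸ˣ))) z‖ ^ 2 +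
      ‖covDivL2K ℂ c₀ ((η : ℂ))⁻¹ (adTransportW φ fun _ : Bond d (towerP L m (n + 1)) => (1 : 𝔸ˣ)⁻¹) z‖ ^ 2 + ‖z‖ ^ 2)) (fun _ => rfl)
    (fun w => GpOfUk L m n φ η U a' hposU (RofUk L m n φ η U (covDivL2K ℂ c₀ ((η : ℂ))⁻¹ (adTransportW φ fun b => (U b)⁻¹) w)))
    (fun w => GpOfUk L m n φ η V a' hposV (RofUk L m n φ η V (covDivL2K ℂ c₀ ((η : ℂ))⁻¹ (adTransportW φ fun b => (V b)⁻¹) w)))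
    hC₁.le hC₁.le hC₂.le (fun w => (HU w).2.2.1) (fun w => (HV w).2.2.1) (fun w => (HU w).2.2.2) (fun w => (HV w).2.2.2)
    (fun w => (HUV w).1) (fun w => (HUV w).2) ha hs hb hκ hκ' hP hP' u v
  rw [LinearMap.comp_apply, LinearMap.comp_apply, LinearMap.adjoint_inner_right, LinearMap.comp_apply, LinearMap.comp_apply,
    LinearMap.adjoint_inner_right, piOfUk_apply, piOfUk_apply, piOfUk_apply, piOfUk_apply]
  refine h.trans ?_
  exact mul_le_mul_of_nonneg_right (mul_le_mul_of_nonneg_right (mul_le_mul_of_nonneg_right hΘ1 hδ0) (Real.sqrt_nonneg _)) (Real.sqrt_nonneg _)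

end Literature.MathematicalPhysics.QuantumFieldTheory.Balaban1983to89.B9Eq3120DeltaPiPrimeFormTwoBackgroundsClosed

end
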